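import Summits.BirchSwinnertonDyer.Rank1Residual.Additive.X4RankZeroUpperHalfOfShaDvd
import Summits.BirchSwinnertonDyer.Rank1Residual.Additive.BudgetFromSelmerGroup
import Summits.BirchSwinnertonDyer.Rank1Residual.Additive.X4RankZeroQuadraticBranchLower
import HarnessLib

/-!
# X4(M), rank `0`, `p = 3`: the UPPER half and the class ENDs of record with Delbourgo 1998 Prop. 4
# SUPPLIED AT THE PAIR by its exact (M) reading — `hDel` and `hPal` OUT, nothing added
# (cell `b2b-bsdres`, team n1011, ROW T-DEL98X, seat p10 GEN 10, FILE 1)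

HONEST FRAMING (cell `b2b-bsdres`, run/shared/lean/b2b/bsd-rank1-residual/, verbatim in every
file): the goal of the cell is to DELETE the COMBINATION-SHAPED residual classes of the
Birch–Swinnerton-Dyer formula for ALL analytic-rank `≤ 1` elliptic curves over `ℚ` — "full BSD
formula for every rank `≤ 1` curve in class `C`" assembled STRICTLY from published theorems — so
that the rank-`≤ 1` remainder becomes exactly the CONSTRUCTION-SHAPED classes, which are TYPED
(missing-input `Prop`s), NOT attempted. This is not "finishing BSD". Team n1011 (N10 / N11, the
additive block `X4 ∧ p = 3`): research route; TOOL + END-twin theorems only — no definition, no named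
fact, no `sorry`; nothing booked; no residual-map mark / label / count moved; X4(M) stays
CONSTRUCTION-SHAPED. NOTHING of additive-p1's / additive-p4's / p06's / p07's / r2's is edited: every
declaration below is NEW and consumes theirs BY NAME.

## What and why

Every rank-`0` UPPER-half END of X4(M) (`ord_p j(E) < 0`) reads the control theorem at the additive
prime through the named fact `hDel : Delbourgo1998.prop4_rankZero_pow_dvd_constantCoeff` (cell registry
A75, Delbourgo 1998 Thm. 3 + Prop. 4 "weaker than print": for every `g ∈ char_Λ X(E/ℚ_∞)`,
`p ^ (ord_p #Ш(E)[p^∞] + ord_p ∏ᶠ_{v ∤ p} c_v) ∣ g(0) · #E(ℚ)²`), and only through its conclusion AT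
THE PAIR — the single call that n1011-p06's T-CTL-UP FILE 3a (`Additive/X4RankZeroUpperHalfOfShaDvd`)
abstracts as the pointwise supplier `hdivAt`. The rank-`0` LOWER-half ENDs of the SAME class read the
EXACT (M) form of the same proposition, `hDelX : Delbourgo1998.prop4_rankZero_constantCoeff_eq_unit_mul_of_potMult`
(registry A181, Delbourgo 1998 Prop. 4 + §2.2 Lemma (ii): `char = (g₀)` and
`g₀(0) · #E(ℚ)² = u · #Ш(E)[p^∞] · ∏ᶠ_{v ∤ p} c_v`, `u ∈ ℤ_p^×`). AT AN (M) PAIR THE EXACT FORM IMPLIES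
THE WEAK ONE (every `g ∈ (g₀)` is `h · g₀`; `p ^ ord_p n ∣ n`): §1 below, forty lines of `ℤ_p`
bookkeeping. Hence on every rank-`0` X4(M) END that displays BOTH readings, `hDel` can be DROPPED with
NOTHING added. At `p = 3` (`3 ≡ 3 (mod 4)`: odd branch, twist by `−3`, `Ω⁻`) the Pal-period fact
`hPal : Pal2012.thm32_…_of_prime_one_mod_four` (A76; anyway a theorem of the tree,
`Additive/PalTwistPeriodHolds`) is IDLE on these ENDs — the lower half at `p ≡ 3 (mod 4)` is
`ClassX4M.missingLowerBoundAt_rankZero_of_chiBranchLowerOdd hDelX hGZK hmod hmodD` — and is dropped too;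
its removal is HYGIENE (an idle binder), NOT a discharge (referee-1 GEN 46, dx-2). The `hDel` removal is
the §K.2 D-2 candidate: pair (route 2's (M) END of record `BudgetFromSelmerGroup.lean:111`, A75), the
replacing fact A181 being displayed on that END (dx-1: §1 is the kernel implication; dx-2; dx-3 CS-1).

* §1 `PotMult.shaDvdAt_of_exactLeadingTerm` — A181 ⟹ p06's `hdivAt` at every additive potentially
  multiplicative rank-`0` pair, every odd `p`.
* §2 `X4RankZeroTwistOdd.shaOrder_le_of_shaDvd` / `…missingUpperBoundAt_of_shaDvd` — additive-p4's
  `X4RankZeroTwistOdd.shaOrder_le` / `…missingUpperBoundAt` (line V9, `p ≡ 3 (mod 4)`) with `hDel`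
  replaced by the ABSTRACT supplier, over p06's odd core `AdditiveTwistOdd.shaOrder_le_of_leadingTerm_of_shaDvd`
  BY NAME (p06's FILE 3b has only the Prop-4.14-specialised form).
* §3 `ClassX4M.missingUpperBoundAt_three_rankZero_of_chiBranch_of_surj_of_shaDvd` (abstract supplier) and
  `ClassX4M.missingUpperBoundAt_three_rankZero_of_surj_of_exactLeadingTerm` — the (M)@3 UPPER half
  `ord₃ #Ш(E) ≤ ord₃ #Ш_an(E)` from {A181 `hDelX`, GZK, modularity `hmod` `hmodD`, Kato's half-eigen
  divisibility A136 `hKato`}: n1011-p14's `ClassX4M.missingUpperBoundAt_three_rankZero_of_surj'` /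
  the `_noL20` chain with `hDel ↦ hDelX`; tower of the multiplicative twist model by
  `ClassX4M.towerSurj_twist_negThree_of_surj`, `c₃(E)` a unit by `ClassX4M.not_dvd_tamagawaNumberAt`.
* §4 the ENDs: `ClassX4M.bsdp_three_rankZero_of_surj_of_lower_of_exactLeadingTerm`,
  `…_of_shaAn_unit_of_exactLeadingTerm`, `ClassX4M.missingInputAt_iff_lower_three_rankZero_of_surj_of_exactLeadingTerm`,
  and the three END TWINS with binder diff EXACTLY {`hDel`, `hPal`} ↦ ∅, NOTHING added, conclusion and
  row universe (X4(M) ∧ surj(3) ∧ `r_an = 0`) identical: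
  - `ClassX4M.bsdp_three_rankZero_of_surj_of_quadraticBranchLower_exact` — additive-p4's
    `ClassX4M.bsdp_rankZero_of_surj_of_quadraticBranchLower` at `3`: named facts 7 ↦ 5;
  - `ClassX4M.bsdp_three_rankZero_of_surj_of_katoHalf_of_firstUnitIndex_of_budget_exact` — p07's
    `…_of_firstUnitIndex_of_budget` at `3`: 7 ↦ 5 = {hK, hDelX, hGZK, hmod, hmodD};
  - `ClassX4M.bsdp_three_rankZero_of_surj_of_katoHalf_of_firstUnitIndex_of_pow_le_card_selmerGroup_exact`
    — route 2's (M) END OF RECORD (ARM σ, `Additive/BudgetFromSelmerGroup.lean`): 8 ↦ 6 =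
    {hK, hDelX, hGZK, hmod, hmodD, h414}.

What is NOT claimed: no new row is covered and nothing is booked — the twins RE-KEY existing ENDs on a
strict sub-list of their displayed named facts (route 2 prices); A75 itself is untouched and stays the
input of every END that does not display A181; the X3♯(M) twins and the X4♯(G-ord)@3 twins (supplier
from Delbourgo 2002 (B) at `3`, cyclotomic-variable generator — FILE 2) are not here. Axioms standard.

References: [Delbourgo1998] Thm. 3 (p. 143), Prop. 4 (p. 144), §2.2 Lemma (ii) (p. 139);
[Kato2004Asterisque] Thm. 17.4 (3) (p. 273); [Wuthrich2014] Thm. 4, Lemma 20, Cor. 19; [GreenbergLNM1716]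
Prop. 4.14; [Miller2011LMS] Def. 1.1; cells/n1011/PLAN.md §K.2; names line cells/n1011/INBOX.md 07:53Z.
-/

noncomputable section

open scoped Classical MatrixGroups ModularForm NumberField

open CongruenceSubgroup WeierstrassCurve NumberField Literature.NumberTheory.EllipticCurves
  Literature.NumberTheory.EllipticCurves.ModularForms
  Literature.NumberTheory.EllipticCurves.Rank1Residual
  Literature.NumberTheory.EllipticCurves.Rank1Residual.Typed
  IsDedekindDomain Rat.HeightOneSpectrum

/-! ### §1 The exact (M) reading supplies the weak one AT THE PAIR -/

namespace Summit.BirchSwinnertonDyer.Rank1Residual.AdditivePotMult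

open Additive

variable {W : WeierstrassCurve ℚ} [W.IsElliptic] [W.IsGloballyMinimal] {p : ℕ} [hp : Fact p.Prime]

/-- **A181 ⟹ A75 AT THE PAIR.** On an additive, potentially multiplicative pair `(E, p)` (`p ≠ 2`,
`ord_p j(E) < 0`) of analytic rank `0`, Delbourgo's EXACT rank-`0` leading term
(`hDelX : Delbourgo1998.prop4_rankZero_constantCoeff_eq_unit_mul_of_potMult`: `char_Λ X = (g₀)`,
`g₀(0) · #E(ℚ)² = u · #Ш(E)[p^∞] · ∏ᶠ_{v ∤ p} c_v`) gives, for EVERY cyclotomic datum and EVERY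
`g ∈ char_Λ X`, the divisibility `p ^ (ord_p #Ш(E)[p^∞] + ord_p ∏ᶠ_{v ∤ p} c_v) ∣ g(0) · #E(ℚ)²` — i.e.
n1011-p06's pointwise supplier shape `hdivAt` (`Additive/X4RankZeroUpperHalfOfShaDvd.lean`), the ONE
thing the upper-half assemblies use of A75. Proof: `g = h · g₀` and `p ^ ord_p n ∣ n`.
[cite: Delbourgo1998, Prop. 4 (p. 144), Thm. 3 (p. 143) and §2.2 Lemma (ii) (p. 139)] -/
theorem PotMult.shaDvdAt_of_exactLeadingTerm
    (hDelX : Delbourgo1998.prop4_rankZero_constantCoeff_eq_unit_mul_of_potMult)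
    (hpm : PotMult W p) (hp2 : p ≠ 2) (hr : W.analyticRank = 0) :
    ∀ (κ : ZpExtension ℚ p) (γ : Field.absoluteGaloisGroup ℚ), κ.IsCyclotomic →
      κ.IsTopGenerator γ → ∀ D : W.SelmerDualData κ γ, Finite W.sha → Finite W.toAffine.Point →
      ∀ g ∈ D.charIdeal,
        (p : ℤ_[p]) ^ (padicValNat p (Nat.card (AddCommGroup.primaryComponent W.sha p)) +
            padicValNat p (∏ᶠ v : HeightOneSpectrum (𝓞 ℚ),
              if (p : 𝓞 ℚ) ∈ v.asIdeal then 1 else W.tamagawaNumberAt v)) ∣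
          PowerSeries.constantCoeff g * ((Nat.card W.toAffine.Point : ℕ) : ℤ_[p]) ^ 2 := by
  intro κ γ hκ hγ D hfin hE g hg
  obtain ⟨-, g₀, -, hspan, u, hu⟩ := hDelX W p hp2 hpm.1 hpm.2 hr hfin hE κ γ hκ hγ D
  rw [hspan, Ideal.mem_span_singleton'] at hg
  obtain ⟨h, rfl⟩ := hg
  set S : ℕ := Nat.card (AddCommGroup.primaryComponent W.sha p) with hS
  set T : ℕ := ∏ᶠ v : HeightOneSpectrum (𝓞 ℚ),
    (if (p : 𝓞 ℚ) ∈ v.asIdeal then 1 else W.tamagawaNumberAt v) with hT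
  -- `p ^ ord_p S ∣ S` and `p ^ ord_p T ∣ T` in `ℕ`, hence in `ℤ_[p]`
  have hSd : (p : ℤ_[p]) ^ padicValNat p S ∣ (S : ℤ_[p]) := by
    have := Nat.cast_dvd_cast (α := ℤ_[p]) (pow_padicValNat_dvd (p := p) (n := S))
    simpa only [Nat.cast_pow] using this
  have hTd : (p : ℤ_[p]) ^ padicValNat p T ∣ (T : ℤ_[p]) := by
    have := Nat.cast_dvd_cast (α := ℤ_[p]) (pow_padicValNat_dvd (p := p) (n := T))
    simpa only [Nat.cast_pow] using this
  have hST : (p : ℤ_[p]) ^ (padicValNat p S + padicValNat p T) ∣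
      (u : ℤ_[p]) * (S : ℤ_[p]) * (T : ℤ_[p]) := by
    rw [pow_add, mul_assoc]
    exact Dvd.dvd.mul_left (mul_dvd_mul hSd hTd) _
  -- `(h · g₀)(0) · #E(ℚ)² = h(0) · (g₀(0) · #E(ℚ)²) = h(0) · (u · S · T)`
  rw [map_mul, mul_assoc, hu]
  exact Dvd.dvd.mul_left hST _

end Summit.BirchSwinnertonDyer.Rank1Residual.AdditivePotMult

/-! ### §2 X4, `p ≡ 3 (mod 4)`: additive-p4's odd assembly on the ABSTRACT supplier -/

namespace Summit.BirchSwinnertonDyer.Rank1Residual.Additive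

section OddAbstract

variable (W : WeierstrassCurve ℚ) [W.IsElliptic] [W.IsGloballyMinimal] (p : ℕ) [hp : Fact p.Prime]

/-- **X4 ∧ `r_an = 0`, `p ≡ 3 (mod 4)`, semistable twist `W = C • V^{(−p)}` with `ρ̄_{V,pⁿ}` onto,
granted `ChiBranchLeadingTermOddBigImageAt W p`: `#Ш_an(E) = q` with
`ord_p #Ш(E) ≤ ord_p q + ord_p c_p(E)`** — additive-p4's `X4RankZeroTwistOdd.shaOrder_le` (line V9)
token for token, with the named fact `hDel` replaced by n1011-p06's ABSTRACT pointwise supplier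
`hdivAt` and the assembly core being p06's `AdditiveTwistOdd.shaOrder_le_of_leadingTerm_of_shaDvd`
(T-CTL-UP FILE 3a) BY NAME. Suppliers: Delbourgo's A75 record (`shaDvdAt_of_prop4`), its exact (M)
reading A181 (`PotMult.shaDvdAt_of_exactLeadingTerm`, §1), Greenberg's Prop. 4.14 road
(`shaDvdAt_of_prop414`). [cite: Kato2004Asterisque, Thm. 17.4 (3) (p. 273)]
[cite: Delbourgo1998, Prop. 4 (p. 144) (shape of the abstracted input only)] [cite: Miller2011LMS, Def. 1.1] -/
theorem X4RankZeroTwistOdd.shaOrder_le_of_shaDvd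
    (hdivAt : ∀ (κ : ZpExtension ℚ p) (γ : Field.absoluteGaloisGroup ℚ), κ.IsCyclotomic →
      κ.IsTopGenerator γ → ∀ D : W.SelmerDualData κ γ, Finite W.sha → Finite W.toAffine.Point →
      ∀ g ∈ D.charIdeal,
        (p : ℤ_[p]) ^ (padicValNat p (Nat.card (AddCommGroup.primaryComponent W.sha p)) +
            padicValNat p (∏ᶠ v : HeightOneSpectrum (𝓞 ℚ),
              if (p : 𝓞 ℚ) ∈ v.asIdeal then 1 else W.tamagawaNumberAt v)) ∣
          PowerSeries.constantCoeff g * ((Nat.card W.toAffine.Point : ℕ) : ℤ_[p]) ^ 2)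
    (hGZK : rank_eq_analyticRank_of_analyticRank_le_one) (hmod : hasEntireLFunction_rat)
    (hBC : ChiBranchLeadingTermOddBigImageAt W p)
    (hp4 : p % 4 = 3) (hr : W.analyticRank = 0) (hX : ClassX4 W p)
    (V : WeierstrassCurve ℚ) [V.IsElliptic] [V.IsGloballyMinimal]
    (C : VariableChange ℚ) (hC : C • V.quadraticTwist (-(p : ℚ)) = W) (hV : GoodOrd V p ∨ Mult V p)
    (hsurj : ∀ n : ℕ, V.HasSurjectiveModNGaloisRep (p ^ n : ℕ))
    {N : ℕ} [NeZero N] {f : CuspForm (Gamma0 N) 2} (hf : IsNewformOf V f)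
    (ϖ : ℚ) (hϖ : (ϖ : ℝ) * V.imaginaryPeriodRat = minusPeriod f) :
    ∃ q : ℚ, shaAn W = (q : ℂ) ∧
      (padicValNat p W.shaOrder : ℤ) ≤
        padicValRat p q + padicValNat p (W.tamagawaNumberAt ((primesEquiv (R := 𝓞 ℚ)).symm ⟨p, hp.out⟩)) := by
  have hp2 : p ≠ 2 := by omega
  have hC' : C • V.quadraticTwist (((-(p : ℤ)) : ℤ) : ℚ) = W := by push_cast; exact hC
  have hu : padicValRat p (C.u : ℚ) = 0 :=
    padicValRat_u_eq_zero_of_twist_pm_p p hp2 V W (hV.elim (fun h ↦ Or.inl h.1) Or.inr)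
      (Or.inr rfl) C hC'
  exact AdditiveTwistOdd.shaOrder_le_of_leadingTerm_of_shaDvd W p hdivAt hGZK hmod hp4 hr hX.2.1 V C hC
    hu hf ϖ hϖ fun _ _ hκ hγ hγ' D ↦ (hBC V hp4 ⟨C, hC⟩ hV hsurj hκ hγ hγ' hf D ϖ hϖ).2

/-- **The typed UPPER half `ord_p #Ш(E) ≤ ord_p #Ш_an(E)` on X4 at `p ≡ 3 (mod 4)` whenever
`p ∤ c_p(E)`, granted the typed Kato-branch input, on the ABSTRACT supplier** — additive-p4's
`X4RankZeroTwistOdd.missingUpperBoundAt` with `hDel ↦ hdivAt`. [cite: Kato2004Asterisque, Thm. 17.4 (3) (p. 273)]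
[cite: Delbourgo1998, Prop. 4 (p. 144) (shape of the abstracted input only)] [cite: Miller2011LMS, Def. 1.1] -/
theorem X4RankZeroTwistOdd.missingUpperBoundAt_of_shaDvd
    (hdivAt : ∀ (κ : ZpExtension ℚ p) (γ : Field.absoluteGaloisGroup ℚ), κ.IsCyclotomic →
      κ.IsTopGenerator γ → ∀ D : W.SelmerDualData κ γ, Finite W.sha → Finite W.toAffine.Point →
      ∀ g ∈ D.charIdeal,
        (p : ℤ_[p]) ^ (padicValNat p (Nat.card (AddCommGroup.primaryComponent W.sha p)) +
            padicValNat p (∏ᶠ v : HeightOneSpectrum (𝓞 ℚ),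
              if (p : 𝓞 ℚ) ∈ v.asIdeal then 1 else W.tamagawaNumberAt v)) ∣
          PowerSeries.constantCoeff g * ((Nat.card W.toAffine.Point : ℕ) : ℤ_[p]) ^ 2)
    (hGZK : rank_eq_analyticRank_of_analyticRank_le_one) (hmod : hasEntireLFunction_rat)
    (hBC : ChiBranchLeadingTermOddBigImageAt W p)
    (hp4 : p % 4 = 3) (hr : W.analyticRank = 0) (hX : ClassX4 W p)
    (V : WeierstrassCurve ℚ) [V.IsElliptic] [V.IsGloballyMinimal]
    (C : VariableChange ℚ) (hC : C • V.quadraticTwist (-(p : ℚ)) = W) (hV : GoodOrd V p ∨ Mult V p)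
    (hsurj : ∀ n : ℕ, V.HasSurjectiveModNGaloisRep (p ^ n : ℕ))
    {N : ℕ} [NeZero N] {f : CuspForm (Gamma0 N) 2} (hf : IsNewformOf V f)
    (ϖ : ℚ) (hϖ : (ϖ : ℝ) * V.imaginaryPeriodRat = minusPeriod f)
    (htam : ¬ p ∣ W.tamagawaNumberAt ((primesEquiv (R := 𝓞 ℚ)).symm ⟨p, hp.out⟩)) :
    MissingUpperBoundAt W p := by
  obtain ⟨q, hq, hle⟩ := X4RankZeroTwistOdd.shaOrder_le_of_shaDvd W p hdivAt hGZK hmod hBC hp4 hr hX V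
    C hC hV hsurj hf ϖ hϖ
  refine ⟨q, hq, ?_⟩
  rw [padicValNat.eq_zero_of_not_dvd htam, Nat.cast_zero, add_zero] at hle
  exact hle

end OddAbstract

end Summit.BirchSwinnertonDyer.Rank1Residual.Additive

/-! ### §3 X4(M) at `p = 3`, rank `0`: the UPPER half on the abstract supplier / on A181 -/

namespace Summit.BirchSwinnertonDyer.Rank1Residual.AdditivePotMult

open Additive Additive.CensusQ6

variable {W : WeierstrassCurve ℚ} [W.IsElliptic] [W.IsGloballyMinimal]

/-- **X4(M) ∧ `p = 3` ∧ `r_an = 0` ∧ surj(3), on the ABSTRACT supplier: `Typed.MissingUpperBoundAt W 3`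
from the typed odd-branch input `ChiBranchLeadingTermOddBigImageAt W 3`** — n1011-p14's
`ClassX4M.missingUpperBoundAt_three_rankZero_of_chiBranch_of_surj'` (`Additive/X4MThreeUpperHalfTowerFree`)
token for token with `hDel ↦ hdivAt`: twist model `V` multiplicative at `3` with `C • V^{(−3)} = W`
(`ClassX4M.exists_mult_pStar_twist_model`), tower of `V` from surj(3) of `E`
(`ClassX4M.towerSurj_twist_negThree_of_surj`), newform / `Ω⁻` ratio from `hmodD`, `c₃(E)` a unit
(`ClassX4M.not_dvd_tamagawaNumberAt`). NO `ram`, NO Tamagawa, NO Manin, NO `hL20` binder.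
[cite: Kato2004Asterisque, Thm. 17.4 (3) (p. 273)] [cite: Wuthrich2014, Lemma 20 (p. 399)]
[cite: Delbourgo1998, Prop. 4 (p. 144) (shape of the abstracted input only)] -/
theorem ClassX4M.missingUpperBoundAt_three_rankZero_of_chiBranch_of_surj_of_shaDvd
    (hdivAt : ∀ (κ : ZpExtension ℚ 3) (γ : Field.absoluteGaloisGroup ℚ), κ.IsCyclotomic →
      κ.IsTopGenerator γ → ∀ D : W.SelmerDualData κ γ, Finite W.sha → Finite W.toAffine.Point →
      ∀ g ∈ D.charIdeal,
        (3 : ℤ_[3]) ^ (padicValNat 3 (Nat.card (AddCommGroup.primaryComponent W.sha 3)) +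
            padicValNat 3 (∏ᶠ v : HeightOneSpectrum (𝓞 ℚ),
              if ((3 : ℕ) : 𝓞 ℚ) ∈ v.asIdeal then 1 else W.tamagawaNumberAt v)) ∣
          PowerSeries.constantCoeff g * ((Nat.card W.toAffine.Point : ℕ) : ℤ_[3]) ^ 2)
    (hGZK : rank_eq_analyticRank_of_analyticRank_le_one) (hmod : hasEntireLFunction_rat)
    (hmodD : nonempty_modularParametrizationData)
    (hBCodd : ChiBranchLeadingTermOddBigImageAt W 3)
    (hX : ClassX4M W 3) (hr : W.analyticRank = 0) (hsurj : Surj W 3) :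
    MissingUpperBoundAt W 3 := by
  obtain ⟨V, iV, iVm, C, hV, hC⟩ := hX.exists_mult_pStar_twist_model
  have hC' : C • V.quadraticTwist (-3 : ℚ) = W := by norm_num at hC; exact hC
  haveI : NeZero (V.conductorNorm ℤ) := ⟨(V.conductorNorm_pos_holds).ne'⟩
  obtain ⟨Dm⟩ := hmodD V
  obtain ⟨ϖ', -, hϖ'⟩ := exists_rat_mul_imaginaryPeriodRat_eq_minusPeriod Dm
  exact X4RankZeroTwistOdd.missingUpperBoundAt_of_shaDvd W 3 hdivAt hGZK hmod hBCodd (by norm_num) hr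
    hX.1 V C (by push_cast; exact hC') (Or.inr hV)
    (hX.towerSurj_twist_negThree_of_surj hsurj V C hC') Dm.isNewformOf ϖ' hϖ'
    hX.not_dvd_tamagawaNumberAt

/-- **X4(M) ∧ `r_an(E) = 0` ∧ surj(3) at `p = 3`: the UPPER half `ord₃ #Ш(E) ≤ ord₃ #Ш_an(E)` from
{Delbourgo 1998 Prop. 4 EXACT (M) reading A181 `hDelX`, GZK `hGZK`, modularity `hmod` `hmodD`, Kato's
divisibility read on the `ω`-component A136 `hKato`}** — the tree's
`ClassX4M.missingUpperBoundAt_rankZero_of_surj_noL20` / `…three_rankZero_of_surj'` with the binder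
surgery `{hDel} ↦ {hDelX}` (§1 supplies `hDel`'s one use from `hDelX`; the branch input discharged by
`PotMult.chiBranchLeadingTermOddBigImageAt_of_halfFact`). NO `ram`, NO Tamagawa, NO Manin, NO `hL20`,
NO `j`-witness hypothesis. X4(M) stays CONSTRUCTION-SHAPED; nothing booked.
[cite: Delbourgo1998, Prop. 4 (p. 144) and §2.2 Lemma (ii) (p. 139)] [cite: Kato2004Asterisque, Thm. 17.4 (3) (p. 273)]
[cite: Wuthrich2014, Thm. 4 (p. 383), Lemma 20 (p. 399), Cor. 19 (p. 398)] -/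
theorem ClassX4M.missingUpperBoundAt_three_rankZero_of_surj_of_exactLeadingTerm
    (hDelX : Delbourgo1998.prop4_rankZero_constantCoeff_eq_unit_mul_of_potMult)
    (hGZK : rank_eq_analyticRank_of_analyticRank_le_one) (hmod : hasEntireLFunction_rat)
    (hmodD : nonempty_modularParametrizationData)
    (hKato : Wuthrich2014.kato_halfEigenCharIdeal_dvd_cyclotomicPrime_of_surjective)
    (hX : ClassX4M W 3) (hr : W.analyticRank = 0) (hsurj : Surj W 3) : MissingUpperBoundAt W 3 :=
  ClassX4M.missingUpperBoundAt_three_rankZero_of_chiBranch_of_surj_of_shaDvd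
    ((ClassX4M.potMult W 3 hX).shaDvdAt_of_exactLeadingTerm hDelX (by norm_num) hr) hGZK hmod hmodD
    ((ClassX4M.potMult W 3 hX).chiBranchLeadingTermOddBigImageAt_of_halfFact hKato) hX hr hsurj

/-! ### §4 The class ENDs at `p = 3` with `hDel` (and the idle `hPal`) OUT, nothing added -/

/-- **X4(M) ∧ `r_an(E) = 0` ∧ surj(3): `BSD(E,3)` from the LOWER half** — the tree's
`ClassX4M.bsdp_rankZero_of_surj_of_lower_noL20` at `3` with `{hDel} ↦ {hDelX}`.
[cite: Delbourgo1998, Prop. 4 (p. 144) and §2.2 Lemma (ii) (p. 139)] [cite: Kato2004Asterisque, Thm. 17.4 (3) (p. 273)]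
[cite: Miller2011LMS, §1 and Def. 1.1] -/
theorem ClassX4M.bsdp_three_rankZero_of_surj_of_lower_of_exactLeadingTerm
    (hDelX : Delbourgo1998.prop4_rankZero_constantCoeff_eq_unit_mul_of_potMult)
    (hGZK : rank_eq_analyticRank_of_analyticRank_le_one) (hmod : hasEntireLFunction_rat)
    (hmodD : nonempty_modularParametrizationData)
    (hKato : Wuthrich2014.kato_halfEigenCharIdeal_dvd_cyclotomicPrime_of_surjective)
    (hX : ClassX4M W 3) (hr : W.analyticRank = 0) (hsurj : Surj W 3)
    (hlow : MissingLowerBoundAt W 3) : BSDp W 3 :=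
  bsdp_of_missingPPartAt W 3 hGZK (by rw [hr]; exact zero_le_one)
    (missingPPartAt_of_lower_of_upper W 3 hlow
      (ClassX4M.missingUpperBoundAt_three_rankZero_of_surj_of_exactLeadingTerm hDelX hGZK hmod hmodD
        hKato hX hr hsurj))

/-- **X4(M) ∧ `r_an(E) = 0` ∧ surj(3) ∧ `3 ∤ #Ш_an(E)`: `BSD(E,3)`** — `{hDel} ↦ {hDelX}` form of the
tree's `ClassX4M.bsdp_rankZero_of_surj_of_shaAn_unit_noL20` at `3`.
[cite: Delbourgo1998, Prop. 4 (p. 144) and §2.2 Lemma (ii) (p. 139)] [cite: Kato2004Asterisque, Thm. 17.4 (3) (p. 273)]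
[cite: Miller2011LMS, §1 and Def. 1.1] -/
theorem ClassX4M.bsdp_three_rankZero_of_surj_of_shaAn_unit_of_exactLeadingTerm
    (hDelX : Delbourgo1998.prop4_rankZero_constantCoeff_eq_unit_mul_of_potMult)
    (hGZK : rank_eq_analyticRank_of_analyticRank_le_one) (hmod : hasEntireLFunction_rat)
    (hmodD : nonempty_modularParametrizationData)
    (hKato : Wuthrich2014.kato_halfEigenCharIdeal_dvd_cyclotomicPrime_of_surjective)
    (hX : ClassX4M W 3) (hr : W.analyticRank = 0) (hsurj : Surj W 3)
    {q : ℚ} (hq : shaAn W = (q : ℂ)) (hv : padicValRat 3 q = 0) : BSDp W 3 :=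
  bsdp_of_missingPPartAt W 3 hGZK (by rw [hr]; exact zero_le_one)
    (missingPPartAt_of_upper_of_shaAn_unit W 3
      (ClassX4M.missingUpperBoundAt_three_rankZero_of_surj_of_exactLeadingTerm hDelX hGZK hmod hmodD
        hKato hX hr hsurj) hq hv)

/-- **X4(M) ∧ `r_an(E) = 0` ∧ surj(3): what remains of X4♯ at the pair is EXACTLY the lower half**
(`Typed.X4.MissingInputAt W 3 ↔ MissingLowerBoundAt W 3`), `{hDel} ↦ {hDelX}` form.
[cite: Delbourgo1998, Prop. 4 (p. 144) and §2.2 Lemma (ii) (p. 139)] [cite: Kato2004Asterisque, Thm. 17.4 (3) (p. 273)] -/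
theorem ClassX4M.missingInputAt_iff_lower_three_rankZero_of_surj_of_exactLeadingTerm
    (hDelX : Delbourgo1998.prop4_rankZero_constantCoeff_eq_unit_mul_of_potMult)
    (hGZK : rank_eq_analyticRank_of_analyticRank_le_one) (hmod : hasEntireLFunction_rat)
    (hmodD : nonempty_modularParametrizationData)
    (hKato : Wuthrich2014.kato_halfEigenCharIdeal_dvd_cyclotomicPrime_of_surjective)
    (hX : ClassX4M W 3) (hr : W.analyticRank = 0) (hsurj : Surj W 3) :
    X4.MissingInputAt W 3 ↔ MissingLowerBoundAt W 3 :=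
  ⟨fun h ↦ (lower_and_upper_of_missingPPartAt W 3 h).1, fun h ↦
    missingPPartAt_of_lower_of_upper W 3 h
      (ClassX4M.missingUpperBoundAt_three_rankZero_of_surj_of_exactLeadingTerm hDelX hGZK hmod hmodD
        hKato hX hr hsurj)⟩

/-- **END TWIN 1 — X4(M) ∧ surj(3) ∧ `r_an = 0`: `BSD(E,3)` ⟸ OUR `E♭`-level conjecture on the odd
quadratic branch**, additive-p4's `ClassX4M.bsdp_rankZero_of_surj_of_quadraticBranchLower`
(`Additive/X4RankZeroQuadraticBranchLower.lean`) at `p = 3` with binder diff EXACTLY {`hDel`, `hPal`} ↦ ∅,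
NOTHING added (named facts 7 ↦ 5 = {hDelX, hGZK, hmod, hmodD, hKato}; conclusion identical): the
lower half at `3 ≡ 3 (mod 4)` is the tree's `ClassX4M.missingLowerBoundAt_rankZero_of_chiBranchLowerOdd`
(no Pal period), the upper half §3. X4(M) stays CONSTRUCTION-SHAPED; nothing booked.
[cite: Delbourgo1998, Prop. 4 (p. 144), §2.2 Lemma (ii) (p. 139), Main Conjecture (p. 151) (shape)]
[cite: Kato2004Asterisque, Thm. 17.4 (3) (p. 273)] [cite: Miller2011LMS, §1 and Def. 1.1] -/
theorem ClassX4M.bsdp_three_rankZero_of_surj_of_quadraticBranchLower_exact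
    (hDelX : Delbourgo1998.prop4_rankZero_constantCoeff_eq_unit_mul_of_potMult)
    (hGZK : rank_eq_analyticRank_of_analyticRank_le_one) (hmod : hasEntireLFunction_rat)
    (hmodD : nonempty_modularParametrizationData)
    (hKato : Wuthrich2014.kato_halfEigenCharIdeal_dvd_cyclotomicPrime_of_surjective)
    (hX : ClassX4M W 3) (hr : W.analyticRank = 0) (hsurj : Surj W 3)
    (hc : ∀ (V : WeierstrassCurve ℚ) [V.IsElliptic] [V.IsGloballyMinimal],
      (∃ C : VariableChange ℚ, C • V.quadraticTwist ((-1) ^ ((3 : ℕ) / 2) * (3 : ℕ) : ℚ) = W) →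
        QuadraticBranchLowerDivisibilityAt V 3) :
    BSDp W 3 :=
  ClassX4M.bsdp_three_rankZero_of_surj_of_lower_of_exactLeadingTerm hDelX hGZK hmod hmodD hKato hX hr
    hsurj
    (ClassX4M.missingLowerBoundAt_rankZero_of_chiBranchLowerOdd hDelX hGZK hmod hmodD hX (by norm_num) hr
      (chiBranchLowerLeadingTermOddAt_of_quadraticBranchLower W 3 hc))

/-- **END TWIN 2 — X4(M) ∧ surj(3) ∧ `r_an = 0`: `BSD(E,3)` ⟸ the census record at index `b`
(`MultOddFirstUnitIndexAt W 3 b`) + the budget `BudgetLeLambdaAt 3 E b`**, n1011-p07's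
`ClassX4M.bsdp_three_rankZero_of_surj_of_katoHalf_of_firstUnitIndex_of_budget`
(`AdditivePotMult/PotMultBudgetRankZeroEnds.lean`) with binder diff EXACTLY {`hDel`, `hPal`} ↦ ∅,
NOTHING added (named facts 7 ↦ 5 = {hK, hDelX, hGZK, hmod, hmodD}; conclusion identical; p07's
odd-branch record-to-conjecture step `…_of_budget_odd` and lower half consumed BY NAME). PER PAIR;
EVIDENCE-tier inputs `hrec` / `hbud`; X4(M) stays CONSTRUCTION-SHAPED; nothing booked.
[cite: Kato2004Asterisque, Thm. 17.4 (3) (p. 273)] [cite: Delbourgo1998, Prop. 4 (p. 144) and §2.2 Lemma (ii) (p. 139)]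
[cite: EmertonPollackWeston2006, Cor. 3.2.5 and Thm. 3.1.1 (source of the typed input)] [cite: Miller2011LMS, §1 and Def. 1.1] -/
theorem ClassX4M.bsdp_three_rankZero_of_surj_of_katoHalf_of_firstUnitIndex_of_budget_exact
    (hK : Wuthrich2014.kato_halfEigenCharIdeal_dvd_cyclotomicPrime_of_surjective)
    (hDelX : Delbourgo1998.prop4_rankZero_constantCoeff_eq_unit_mul_of_potMult)
    (hGZK : rank_eq_analyticRank_of_analyticRank_le_one) (hmod : hasEntireLFunction_rat)
    (hmodD : nonempty_modularParametrizationData)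
    (hX : ClassX4M W 3) (hsurj : Surj W 3) (hr : W.analyticRank = 0) {b : ℕ}
    (hrec : MultOddFirstUnitIndexAt W 3 b) (hbud : BudgetLeLambdaAt 3 W b) : BSDp W 3 :=
  ClassX4M.bsdp_three_rankZero_of_surj_of_lower_of_exactLeadingTerm hDelX hGZK hmod hmodD hK hX hr hsurj
    (ClassX4M.missingLowerBoundAt_rankZero_of_chiBranchLowerOdd hDelX hGZK hmod hmodD hX (by norm_num) hr
      (chiBranchLowerLeadingTermOddAt_of_quadraticBranchLower W 3 fun V _ _ hVW ↦
        hX.forall_quadraticBranchLowerDivisibilityAt_of_katoHalf_of_firstUnitIndex_of_budget_odd hK hsurj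
          (by norm_num) hrec hbud V hVW))

/-- **END TWIN 3 — ROUTE 2's (M) END OF RECORD (ARM σ): X4(M) ∧ surj(3) ∧ `r_an = 0` (the N11 (M)
rows, census status `OPEN:LOWER(M)[+TAM]`): `BSD(E,3)` ⟸ the odd record `MultOddFirstUnitIndexAt W 3 b`
+ `3 ^ b ≤ #Sel⁽³⁾(E/ℚ)`**, route 2's
`ClassX4M.bsdp_three_rankZero_of_surj_of_katoHalf_of_firstUnitIndex_of_pow_le_card_selmerGroup`
(`Additive/BudgetFromSelmerGroup.lean`) with binder diff EXACTLY {`hDel`, `hPal`} ↦ ∅, NOTHING added: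
displayed named facts 8 ↦ 6 = {hK (Wuthrich 2014 / Kato half-eigen A136), hDelX (Delbourgo 1998
exact (M) A181), hGZK, hmod, hmodD, h414 (Greenberg Prop. 4.14)}; conclusion and row universe
identical; the Ш-door `budgetLeLambdaAt_of_prop414_of_pow_le_card_selmerGroup` consumed BY NAME.
cells/n1011/PLAN.md §K.2 (D-2: "replaces a displayed NAMED LITERATURE FACT by … a fact already on the
row (net fact list strictly shorter)") — CANDIDATE for the `hDel` removal only (pair (END :111, A75),
replacing fact A181 displayed on :111; referee-1 GEN 46 dx-1..dx-3); the `hPal` removal is HYGIENE (idle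
binder), not a discharge. Referee-1 grades. Nothing booked.
[cite: GreenbergLNM1716, Prop. 4.14 (p. 114)] [cite: Kato2004Asterisque, Thm. 17.4 (3) (p. 273)]
[cite: Delbourgo1998, Prop. 4 (p. 144) and §2.2 Lemma (ii) (p. 139)] [cite: Miller2011LMS, §1 and Def. 1.1] -/
theorem ClassX4M.bsdp_three_rankZero_of_surj_of_katoHalf_of_firstUnitIndex_of_pow_le_card_selmerGroup_exact
    [Fact (Nat.Prime 3)]
    (hK : Wuthrich2014.kato_halfEigenCharIdeal_dvd_cyclotomicPrime_of_surjective)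
    (hDelX : Delbourgo1998.prop4_rankZero_constantCoeff_eq_unit_mul_of_potMult)
    (hGZK : rank_eq_analyticRank_of_analyticRank_le_one) (hmod : hasEntireLFunction_rat)
    (hmodD : nonempty_modularParametrizationData)
    (h414 : Greenberg1999.prop414_noFiniteSubmodule_of_not_dvd_torsionOrder)
    (hX : ClassX4M W 3) (hsurj : Surj W 3) (hr : W.analyticRank = 0) {b : ℕ}
    (hrec : MultOddFirstUnitIndexAt W 3 b) (hSel : 3 ^ b ≤ Nat.card (selmerGroup W (3 : ℤ))) :
    BSDp W 3 :=
  hX.bsdp_three_rankZero_of_surj_of_katoHalf_of_firstUnitIndex_of_budget_exact hK hDelX hGZK hmod hmodD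
    hsurj hr hrec
    (budgetLeLambdaAt_of_prop414_of_pow_le_card_selmerGroup h414 (not_dvd_torsionOrder_of_surj 3 W hsurj)
      hSel)

end Summit.BirchSwinnertonDyer.Rank1Residual.AdditivePotMult

end
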